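/-
Copyright: the b2b-balaban cell (near-miss cell 7), T⁴-continuum CRUX team (coordinator ruling e34b3e0c item (2)),
row-NE7b OWNER lineage `t4-ne7b-p1` (gen 103). Released under the licence of the surrounding project.
-/
import Summits.QuantumFields.BalabanUV.T4Continuum.Spine.NE7b.HealingMap
import Literature.MathematicalPhysics.QuantumFieldTheory.Balaban1983to89.T4LiveClassFibration

/-!
# PINNED EXTRACTION: the per-class RELATIVE partial-sum display is the honest cut of NE7b's numerator — both the
# healing route R-H and the absolute «numerator ∕ floor» architecture of the (α) road R-P1 factor through it
# (row NE7b, node U5c; owner ruling W-ne7bp1-g103-1, memo `t4/b2b-balaban-t4-ne7b-p1/g103/F-RHO-TOWER-g103.md`)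

Cell `pub-balaban`, sub-cell `t4`, spine estimate NE7b (`T4WeightBudget.RelWeightBound`, the cell's OWN estimate — NOT
PRINTED in [Bałaban 1983–89], NOT PROVED).  Crux-route work under `Spine/NE7b/` (like `…NE7b.HealingMap`); it types NO
`T4Continuum/Support` leaf, mints no `Prop` of Bałaban's, carries no `[cite:]` tag; zero `sorry`.

WHY (the owner's located finding F-ne7bp1-g103-1∕2, memo above; checkable arithmetic, zero weight on rank ∕ price).
The (α) road's END record (`B16HistoryTowerStepRangeDataLWR.TowerStepRangeDataLWR`, IR-102-2) reaches the per-key partial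
sum `Σ_{τ ∈ fibre k} weight τ ≤ LIVE k · MULT k · Nup` through TERM-WISE sup-norm factors (M2-B `weight ≤ dead·LIVE·rest`,
`rest ≤ e^{BA}·mass·W`) and the by-VOLUME display (ρ) `Σ_{fibre k} dmass ≤ W K · MULT k`, with the K-UNIFORM letters
`hWi : W K ≤ W∞` and `hBA : log B K t ≤ BA∞`.  At Bałaban's own tower both letters fail for large `K`: (1) the fibre of a
live key contains every history differing from it by FREE DEAD large-field cubes; one extra cube at the finest level has
`≍ n^d L^{dK}(MR₀)^{−d}` placements against a birth factor `exp(−s_B(g₀(K)))` that is only quasi-polynomial in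
`g₀(K)^{−2} ≍ b₀K log L` ([Balaban1989LargeFieldI] p. 175: d = 4 lacks the positive power of the lattice spacing), so (ρ)
forces `W K → ∞`; in print the parts integrated out by 𝐑 are never summation labels — the curly bracket of (1.72) is
exponentiated at the same step, [Balaban1989LargeFieldII] (1.90)–(1.98) p. 388–390, and moved into the action (1.101),
its bulk renormalised by the next step's vacuum-energy counterterms ((1.71) p. 379); (2) `B K t ≥ sup ρ₀ = c_K e^{−l₀}` with
`c_K = (∫ρ_K)∕Z_K ≥ e^{−e₋n₁}c₀∕Z_K` by the END's own (γ)-floor and sites letters, and `−log Z_K ≳ |log m(β)|·#plaquettes(T_η)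
→ ∞` — the bare-field entropy.  Both are the same disease: sup-norm bookkeeping of un-normalised labels.  What Bałaban's
method CAN supply is the partial-sum statement itself, RELATIVE to the full sum — either as a healing injection (route
R-H: `HealingLaws.le_heal`) or as print's own architecture «UV-stability UPPER bound with the pinned genealogy's factors
extracted» over «(2.50)-LOWER floor» (the cell's reading; NOT in print verbatim).  This file names that cut.

WHAT IS PROVED ([folklore]; finite sums; imports `…NE7b.HealingMap` and the Literature module `T4LiveClassFibration`):
* §1 `ExtractionLaws l₀ T A Bad X Badx q` — per cutoff a finite set `X K` of PINNED CLASSES (old live genealogies up to the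
  key's equivalence), their sub-classes `Badx K x ⊆` terms, a cover of the bad class, and THE display: for every `|t| ≤ l₀`
  and `x ∈ X K`, `Σ_{Badx K x} A K t ≤ q K x · Σ_{T K} A K t` with `q K x ≥ 0` source-uniform.  `ExtractionLaws.bad_le`
  (⟹ `Σ_{Bad} A ≤ (Σ_x q K x)·Σ_T A`, the tree's `T4WeightBudget.relWeight_le_sum_of_cover` BY NAME);
  **`ExtractionLaws.ofHealing`** — route R-H's `HealingLaws` IS an instance (its `le_heal` + injectivity give the display,
  `HealingMap.sum_le_mul_sum_of_heal`); **`ExtractionLaws.ofGlobalDomClasses`** — the renewal member P2's CLASS-LEVEL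
  extraction `T4LiveClassFibration`∕`T4GlobalDenominator.GlobalDom` over live classes (class weight `≤ F·nup`, floor
  `nlow ≤ Σ_T`, ratio `nup ≤ C·nlow`) IS an instance with classes = fibres and quotients `C·F` (`1` below the threshold).
* §2 THE ABSOLUTE ARCHITECTURE FACTORS THROUGH IT: `sum_le_mul_sum_of_absolute` — a per-class ABSOLUTE numerator bound
  `Σ_{Badx} A ≤ q·Nup`, a floor `fl ≤ Σ_T A` with `0 < fl`, and an envelope ratio `Nup ≤ R·fl` give the relative display
  with quotient `q·R`; **`ExtractionLaws.ofAbsolute`** packages it per run (the (α) road's «numerator ∕ (2.50)-floor» shape,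
  with the numerator asked AT THE PARTIAL SUM, not per term).
* §4 (v1.1, append-only) THE CONVERSE EMBEDDING: **`regeneration_of_relativeClasses`** ∕ `regeneration_of_extractionLaws` —
  a RELATIVE class-level display (`classWeight c ≤ F K c · Σ_T A` on the bad classes) INHABITS P2's term-level
  `T4LiveClassFibration.Regeneration` with `nlow = nup = Σ_T A`, `C = 1`, `R ≡ 1` and the canonical dead-past factor
  `relDead` — so the count road of record (`HistoryAssemblyTreesLE.hybridNE7_of_treeBinders_canonLE` → `HistoryExitLE` →
  `HistoryTreeShapeLE` → `T4BranchingRecordsGas` → `T4LiveGasToTerms`) consumes the re-cut display VERBATIM, envelope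
  constant `1` instead of `constOf … Nup`.
* §3 THE END: **`relWeightBound_of_extraction`** (two runs' extraction laws over the same term sets and bad classes + a
  common majorant `W`, `W K < 1` from `K₀`, `Σ W < ∞` ⟹ `RelWeightBound`, early steps emptied) and
  **`exists_relWeightBound_of_extraction_majorant`** (the two-rate majorant `V·r^{K − j⋆(K)}` ⟹ SOME `K₀`), verbatim the
  shapes of `HealingMap.relWeightBound_of_healing` ∕ `exists_relWeightBound_of_healing_majorant` one hypothesis weaker.

NOT HERE (honest).  The display `extract` for Bałaban's tower (per pinned old genealogy: the cell's reading of
[Balaban1989LargeFieldII] (1.79)–(1.89) + Thm 1's upper half with the genealogy's operations replaced by their bounds —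
print's KIND, not print's statement; = the row's wall H3^NE7b relocated from terms to partial sums); the cover (R-class
reading, kernel on the carrier: `badGMems` ∕ `fibre`); the count `Σ_x q K x ≤ V·r^{K−j⋆(K)}` (the cell's banking
arithmetic, kernel in the lineage's PRICE road).  BY-NAME EFFECT ON THE WALL: NONE — this file RE-CUTS where the (α)
instance owes an estimate; it discharges nothing.  NE7b NOT PRINTED ∕ NOT PROVED; spine PROVED 0∕9; rung (B)+1 on a
FINITE torus — NOT infinite volume, NOT the mass gap, NOT Clay.
HONEST DEPENDENCY: continuum YM on T⁴ ⇐ BetaPertH ∧ nine spine estimates (0/9 proved); BetaPertH ⇐ (D1) ∧ (D4) ∧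
CAP+tail; G-an2-4 gates asym, D1 and NE2/3/4.  This file changes none of it.
-/

set_option autoImplicit false

open Finset
open Literature.MathematicalPhysics.QuantumFieldTheory.Balaban1983to89
open Literature.MathematicalPhysics.QuantumFieldTheory.Balaban1983to89.T4WeightBudget
open Summit.QuantumFields.BalabanUV.T4Continuum.NE7b.HealingMap

namespace Summit.QuantumFields.BalabanUV.T4Continuum.NE7b.PinnedExtraction

/-! ## §1 The hypothesis shape: per pinned class, a RELATIVE bound on the partial sum -/

section Laws

variable {ι α α' : Type*}

/-- **EXTRACTION LAWS for ONE run** (the hypothesis SHAPE at which the (α) instance honestly owes its estimate of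
print's kind; displayed, never asserted).  Data: per cutoff `K` a finite set `X K` of PINNED CLASSES (source-free), for
each `x` the sub-class `Badx K x` of terms carrying it, and a SOURCE-UNIFORM quotient `q K x`.  Laws: the bad class
consists of terms and is covered by the `Badx`; `q K x ≥ 0`; and THE DISPLAY `extract`: the partial sum over `Badx K x`
is at most `q K x` times the FULL sum, for every `|t| ≤ l₀` — a statement about two integrals of the same density, in
which every normalisation (bare-field entropy, the dead large-field gas, vacuum energies) cancels. [folklore] -/
structure ExtractionLaws (l₀ : ℝ) (T : ℕ → Finset ι) (A : ℕ → ℝ → ι → ℝ) (Bad : ℕ → ℝ → Finset ι)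
    (X : ℕ → Finset α) (Badx : ℕ → α → Finset ι) (q : ℕ → α → ℝ) : Prop where
  /-- the bad class consists of terms -/
  bad_subset : ∀ K t, |t| ≤ l₀ → Bad K t ⊆ T K
  /-- every bad term carries some pinned class -/
  cover : ∀ K t, |t| ≤ l₀ → ∀ τ ∈ Bad K t, ∃ x ∈ X K, τ ∈ Badx K x
  /-- the quotients are non-negative -/
  q_nonneg : ∀ K, ∀ x ∈ X K, 0 ≤ q K x
  /-- THE DISPLAY: the pinned class's partial sum is at most `q` times the full sum, uniformly in the source -/
  extract : ∀ K t, |t| ≤ l₀ → ∀ x ∈ X K, ∑ τ ∈ Badx K x, A K t τ ≤ q K x * ∑ τ ∈ T K, A K t τ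

variable {l₀ : ℝ} {T : ℕ → Finset ι} {A B : ℕ → ℝ → ι → ℝ} {Bad : ℕ → ℝ → Finset ι}
  {X : ℕ → Finset α} {Badx : ℕ → α → Finset ι} {q : ℕ → α → ℝ}
  {X' : ℕ → Finset α'} {Badx' : ℕ → α' → Finset ι} {q' : ℕ → α' → ℝ}

/-- **ONE RUN**: extraction laws + non-negative weights ⟹ the bad class has relative weight `≤ Σ_{x ∈ X K} q K x` at
every cutoff and every `|t| ≤ l₀` (the tree's `relWeight_le_sum_of_cover` BY NAME). [folklore] -/
theorem ExtractionLaws.bad_le (h : ExtractionLaws l₀ T A Bad X Badx q)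
    (hA : ∀ K t, |t| ≤ l₀ → ∀ τ, 0 ≤ A K t τ) (K : ℕ) (t : ℝ) (ht : |t| ≤ l₀) :
    ∑ τ ∈ Bad K t, A K t τ ≤ (∑ x ∈ X K, q K x) * ∑ τ ∈ T K, A K t τ := by
  classical
  have hcov : Bad K t ⊆ (X K).biUnion (Badx K) := fun τ hτ => Finset.mem_biUnion.mpr (h.cover K t ht τ hτ)
  exact relWeight_le_sum_of_cover (X K) (Badx K) (hA K t ht) hcov (h.extract K t ht)

/-- The total of the quotients is non-negative. [folklore] -/
theorem ExtractionLaws.sum_q_nonneg (h : ExtractionLaws l₀ T A Bad X Badx q) (K : ℕ) :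
    0 ≤ ∑ x ∈ X K, q K x :=
  Finset.sum_nonneg (h.q_nonneg K)

/-- Monotonicity in the quotients: larger source-uniform quotients are still extraction laws. [folklore] -/
theorem ExtractionLaws.mono (h : ExtractionLaws l₀ T A Bad X Badx q) {q₁ : ℕ → α → ℝ}
    (hA : ∀ K t, |t| ≤ l₀ → ∀ τ, 0 ≤ A K t τ) (hq : ∀ K, ∀ x ∈ X K, q K x ≤ q₁ K x) :
    ExtractionLaws l₀ T A Bad X Badx q₁ where
  bad_subset := h.bad_subset
  cover := h.cover
  q_nonneg K x hx := (h.q_nonneg K x hx).trans (hq K x hx)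
  extract K t ht x hx := (h.extract K t ht x hx).trans
    (mul_le_mul_of_nonneg_right (hq K x hx) (Finset.sum_nonneg fun τ _ => hA K t ht τ))

/-- **ROUTE R-H IS AN INSTANCE**: healing laws (injective healing into `T K` with the sup-quotient `le_heal`) and
non-negative weights give extraction laws with the SAME pinned classes and quotients
(`HealingMap.sum_le_mul_sum_of_heal`). [folklore] -/
theorem ExtractionLaws.ofHealing {heal : ℕ → α → ι → ι} (h : HealingLaws l₀ T A Bad X Badx heal q)
    (hA : ∀ K t, |t| ≤ l₀ → ∀ τ, 0 ≤ A K t τ) : ExtractionLaws l₀ T A Bad X Badx q where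
  bad_subset := h.bad_subset
  cover := h.cover
  q_nonneg := h.q_nonneg
  extract K t ht x hx := by
    classical
    exact sum_le_mul_sum_of_heal (Badx K x) (T K) (heal K x) (fun τ _ => hA K t ht τ) (h.q_nonneg K x hx)
      (h.heal_mem K x hx) (h.heal_injOn K x hx) (h.le_heal K t ht x hx)

/-- **THE RENEWAL MEMBER P2's CLASS-LEVEL EXTRACTION IS AN INSTANCE**: a `GlobalDom` over LIVE CLASSES
(`T4LiveClassFibration` §2: indices = live classes `classIndex π T`, weights = class weights, a source-free class-level
bad set `Bc K`, class weight `≤ F·nup` on bad classes, floor `nlow ≤` full sum, ratio `nup ≤ C·nlow`, all from `K₀` on)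
and non-negative term weights give extraction laws for the TERMS with pinned classes `Bc K`, sub-classes the FIBRES, bad
class the saturated one, and quotients `C·F K c` from `K₀` on (`1` below `K₀`, where a fibre is at most the whole sum).
The absolute architecture asked AT THE CLASS WEIGHT — exactly the cut of §2. [folklore] -/
theorem ExtractionLaws.ofGlobalDomClasses {γ : Type*} [DecidableEq γ] {π : ℕ → ι → γ} {Bc : ℕ → Finset γ}
    {F : ℕ → γ → ℝ} {nlow nup : ℕ → ℝ → ℝ} {C : ℝ} {K₀ : ℕ} (hl₀ : 0 ≤ l₀)
    (h : T4GlobalDenominator.GlobalDom l₀ (T4LiveClassFibration.classIndex π T)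
      (T4LiveClassFibration.classWeight π T A) (fun K _ => Bc K) F nlow nup C K₀)
    (hC : 0 ≤ C) (hA : ∀ K t, |t| ≤ l₀ → ∀ τ, 0 ≤ A K t τ) :
    ExtractionLaws l₀ T A (T4LiveClassFibration.badOfClass π T fun K _ => Bc K) Bc
      (fun K c => T4LiveClassFibration.fibre π T K c) (fun K c => if K₀ ≤ K then C * F K c else 1) where
  bad_subset K t _ := T4LiveClassFibration.badOfClass_subset K t
  cover K t _ τ hτ :=
    ⟨π K τ, (T4LiveClassFibration.mem_badOfClass.1 hτ).2,
      T4LiveClassFibration.mem_fibre.2 ⟨(T4LiveClassFibration.mem_badOfClass.1 hτ).1, rfl⟩⟩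
  q_nonneg K c hc := by
    by_cases hK : K₀ ≤ K
    · rw [if_pos hK]
      exact mul_nonneg hC (h.F_nonneg K 0 (by simpa using hl₀) hK c hc)
    · rw [if_neg hK]; exact zero_le_one
  extract K t ht c hc := by
    by_cases hK : K₀ ≤ K
    · rw [if_pos hK]
      have hF0 : 0 ≤ F K c := h.F_nonneg K t ht hK c hc
      calc ∑ τ ∈ T4LiveClassFibration.fibre π T K c, A K t τ
          = T4LiveClassFibration.classWeight π T A K t c := rfl
        _ ≤ F K c * nup K t := h.up K t ht hK c hc
        _ ≤ F K c * (C * nlow K t) := mul_le_mul_of_nonneg_left (h.ratio K t ht hK) hF0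
        _ ≤ F K c * (C * ∑ c' ∈ T4LiveClassFibration.classIndex π T K,
              T4LiveClassFibration.classWeight π T A K t c') :=
            mul_le_mul_of_nonneg_left (mul_le_mul_of_nonneg_left (h.low K t ht hK) hC) hF0
        _ = C * F K c * ∑ τ ∈ T K, A K t τ := by rw [T4LiveClassFibration.sum_classWeight]; ring
    · rw [if_neg hK, one_mul]
      exact Finset.sum_le_sum_of_subset_of_nonneg (T4LiveClassFibration.fibre_subset K c)
        fun τ _ _ => hA K t ht τ

end Laws

/-! ## §2 The absolute «numerator ∕ floor» architecture factors through the display -/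

section Absolute

variable {ι α : Type*}

/-- **ABSOLUTE ⟹ RELATIVE, one class**: a per-class ABSOLUTE numerator bound `Σ_{Badx} a ≤ q·Nup` (UV-stability upper
half with the pinned genealogy's factors `q` extracted — print's KIND), a FLOOR `fl ≤ Σ_T a` ((2.50)-lower, integrated,
source-tilted), `0 ≤ q`, and an ENVELOPE RATIO `Nup ≤ R·fl` with `0 ≤ R` (the T-extensive, K-uniform constant
`e^{(e₊+e₋)|T|}·c_up∕c_low` in the cell's reading) give the relative display with quotient `q·R`. [folklore] -/
theorem sum_le_mul_sum_of_absolute (Badx T : Finset ι) {a : ι → ℝ} {q Nup fl R : ℝ}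
    (hq : 0 ≤ q) (hR : 0 ≤ R) (hden : fl ≤ ∑ τ ∈ T, a τ)
    (hnum : ∑ τ ∈ Badx, a τ ≤ q * Nup) (hratio : Nup ≤ R * fl) :
    ∑ τ ∈ Badx, a τ ≤ q * R * ∑ τ ∈ T, a τ :=
  calc ∑ τ ∈ Badx, a τ ≤ q * Nup := hnum
    _ ≤ q * (R * fl) := mul_le_mul_of_nonneg_left hratio hq
    _ ≤ q * (R * ∑ τ ∈ T, a τ) := mul_le_mul_of_nonneg_left (mul_le_mul_of_nonneg_left hden hR) hq
    _ = q * R * ∑ τ ∈ T, a τ := by ring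

variable {l₀ : ℝ} {T : ℕ → Finset ι} {A : ℕ → ℝ → ι → ℝ} {Bad : ℕ → ℝ → Finset ι}
  {X : ℕ → Finset α} {Badx : ℕ → α → Finset ι} {q : ℕ → α → ℝ}

/-- **THE (α) ROAD's ARCHITECTURE, RE-CUT AT THE PARTIAL SUM**: per run, a cover of the bad class by pinned classes,
per-class ABSOLUTE numerator bounds `Σ_{Badx K x} A K t ≤ q K x · Nup K t` (asked AT THE PARTIAL SUM — not derived from
term-wise sup-norm factors), a floor `fl K t ≤ Σ_{T K} A K t` on the window, and a K-UNIFORM envelope ratio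
`Nup K t ≤ R · fl K t`, `0 ≤ R`, give extraction laws with quotients `q K x · R`. [folklore] -/
theorem ExtractionLaws.ofAbsolute {Nup fl : ℕ → ℝ → ℝ} {R : ℝ}
    (bad_subset : ∀ K t, |t| ≤ l₀ → Bad K t ⊆ T K)
    (cover : ∀ K t, |t| ≤ l₀ → ∀ τ ∈ Bad K t, ∃ x ∈ X K, τ ∈ Badx K x)
    (q_nonneg : ∀ K, ∀ x ∈ X K, 0 ≤ q K x) (hR : 0 ≤ R)
    (hden : ∀ K t, |t| ≤ l₀ → fl K t ≤ ∑ τ ∈ T K, A K t τ)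
    (hnum : ∀ K t, |t| ≤ l₀ → ∀ x ∈ X K, ∑ τ ∈ Badx K x, A K t τ ≤ q K x * Nup K t)
    (hratio : ∀ K t, |t| ≤ l₀ → Nup K t ≤ R * fl K t) :
    ExtractionLaws l₀ T A Bad X Badx (fun K x => q K x * R) where
  bad_subset := bad_subset
  cover := cover
  q_nonneg K x hx := mul_nonneg (q_nonneg K x hx) hR
  extract K t ht x hx :=
    sum_le_mul_sum_of_absolute (Badx K x) (T K) (q_nonneg K x hx) hR (hden K t ht) (hnum K t ht x hx) (hratio K t ht)

/-- The quotient total of the absolute architecture is the extracted total times the envelope ratio. [folklore] -/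
theorem sum_mul_const_eq (X : Finset α) (q : α → ℝ) (R : ℝ) : ∑ x ∈ X, q x * R = (∑ x ∈ X, q x) * R :=
  (Finset.sum_mul X q R).symm

end Absolute

/-! ## §3 The END: two runs' extraction laws ⟹ NE7b's output shape `RelWeightBound` -/

section End

variable {ι α α' : Type*} {l₀ : ℝ} {T : ℕ → Finset ι} {A B : ℕ → ℝ → ι → ℝ} {Bad : ℕ → ℝ → Finset ι}
  {X : ℕ → Finset α} {Badx : ℕ → α → Finset ι} {q : ℕ → α → ℝ}
  {X' : ℕ → Finset α'} {Badx' : ℕ → α' → Finset ι} {q' : ℕ → α' → ℝ}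

/-- **THE END AT THE HONEST CUT: two runs' extraction laws ⟹ `RelWeightBound`.**  Extraction laws for run A (pinned
classes `X`, quotients `q`) and run B (`X'`, `q'`) over the SAME source-free term sets `T K` and bad classes `Bad K t`
(run B's weights after node O's partial summation onto run A's index), non-negative weights, and a common majorant
`W` with `Σ_x q K x ≤ W K`, `Σ_x q' K x ≤ W K`, `W K < 1` for `K ≥ K₀`, `Σ_K W K < ∞` give
`T4WeightBudget.RelWeightBound` with the bad classes EMPTIED and the weights ZEROED below `K₀`
(`relWeightBound_of_eventually`).  Every analytic input (the display `extract` per pinned class, the cover, the count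
behind `W`) is a hypothesis here. [folklore] -/
theorem relWeightBound_of_extraction {K₀ : ℕ} {W : ℕ → ℝ}
    (hA : ExtractionLaws l₀ T A Bad X Badx q) (hB : ExtractionLaws l₀ T B Bad X' Badx' q')
    (hA0 : ∀ K t, |t| ≤ l₀ → ∀ τ, 0 ≤ A K t τ) (hB0 : ∀ K t, |t| ≤ l₀ → ∀ τ, 0 ≤ B K t τ)
    (hWA : ∀ K, K₀ ≤ K → ∑ x ∈ X K, q K x ≤ W K) (hWB : ∀ K, K₀ ≤ K → ∑ x ∈ X' K, q' K x ≤ W K)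
    (h1 : ∀ K, K₀ ≤ K → W K < 1) (hs : Summable W) :
    RelWeightBound l₀ T A B (fun K t => if K₀ ≤ K then Bad K t else ∅) (Set.indicator {K | K₀ ≤ K} W) :=
  relWeightBound_of_eventually (fun K t ht _ => hA.bad_subset K t ht)
    (fun K hK => (hA.sum_q_nonneg K).trans (hWA K hK)) h1 hs
    (fun K t ht hK => (hA.bad_le hA0 K t ht).trans
      (mul_le_mul_of_nonneg_right (hWA K hK) (Finset.sum_nonneg fun τ _ => hA0 K t ht τ)))
    (fun K t ht hK => (hB.bad_le hB0 K t ht).trans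
      (mul_le_mul_of_nonneg_right (hWB K hK) (Finset.sum_nonneg fun τ _ => hB0 K t ht τ)))

/-- **THE END + the two-rate majorant ⟹ `RelWeightBound` from SOME `K₀` on.**  If both runs' quotient totals are bounded
by the tree's weight majorant `V·r^{K − j⋆(K)}` (`0 < r < 1`, `0 ≤ V`, `c·K ≤ K − j⋆(K)` with `0 < c` — the cell's
banking COUNT over pinned genealogies with a per-event decay; a hypothesis here), then the majorant is summable and
eventually `< 1` (`T4WeightBudget.summable_weightMajorant` ∕ `eventually_weightMajorant_lt`), so some `K₀` yields the
`RelWeightBound`. [folklore] -/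
theorem exists_relWeightBound_of_extraction_majorant {r V c : ℝ} {jstar : ℕ → ℕ}
    (hA : ExtractionLaws l₀ T A Bad X Badx q) (hB : ExtractionLaws l₀ T B Bad X' Badx' q')
    (hA0 : ∀ K t, |t| ≤ l₀ → ∀ τ, 0 ≤ A K t τ) (hB0 : ∀ K t, |t| ≤ l₀ → ∀ τ, 0 ≤ B K t τ)
    (h0 : 0 < r) (hr1 : r < 1) (hV : 0 ≤ V) (hc : 0 < c)
    (hfrac : ∀ K : ℕ, c * K ≤ ((K - jstar K : ℕ) : ℝ))
    (hmajA : ∀ K, ∑ x ∈ X K, q K x ≤ V * r ^ (K - jstar K))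
    (hmajB : ∀ K, ∑ x ∈ X' K, q' K x ≤ V * r ^ (K - jstar K)) :
    ∃ K₀ : ℕ, RelWeightBound l₀ T A B (fun K t => if K₀ ≤ K then Bad K t else ∅)
      (Set.indicator {K | K₀ ≤ K} fun K => V * r ^ (K - jstar K)) := by
  obtain ⟨K₀, hK₀⟩ := Filter.eventually_atTop.mp
    (eventually_weightMajorant_lt h0 hr1 hV hc one_pos hfrac)
  exact ⟨K₀, relWeightBound_of_extraction hA hB hA0 hB0 (fun K _ => hmajA K) (fun K _ => hmajB K) hK₀
    (summable_weightMajorant h0 hr1 hV hc hfrac)⟩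

/-- **THE ABSOLUTE ARCHITECTURE's END, with the envelope ratio made explicit**: if both runs satisfy the absolute
architecture of §2 with extracted totals `Σ_x q K x ≤ V·r^{K−j⋆(K)}` and a common K-UNIFORM envelope ratio `R ≥ 0`, then
some `K₀` yields the `RelWeightBound` with weights `(V·R)·r^{K−j⋆(K)}` — the K-uniformity of `R` is exactly what the
majorant's summability consumes; a `K`-dependent ratio growing faster than `r^{−(K−j⋆(K))}` (as the END's `W K·e^{BA}`
does at Bałaban's tower, memo F-ne7bp1-g103-1∕2) yields nothing. [folklore] -/
theorem exists_relWeightBound_of_absolute_majorant {r V c R : ℝ} {jstar : ℕ → ℕ}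
    (hA : ExtractionLaws l₀ T A Bad X Badx (fun K x => q K x * R))
    (hB : ExtractionLaws l₀ T B Bad X' Badx' (fun K x => q' K x * R))
    (hA0 : ∀ K t, |t| ≤ l₀ → ∀ τ, 0 ≤ A K t τ) (hB0 : ∀ K t, |t| ≤ l₀ → ∀ τ, 0 ≤ B K t τ)
    (h0 : 0 < r) (hr1 : r < 1) (hV : 0 ≤ V) (hc : 0 < c) (hR : 0 ≤ R)
    (hfrac : ∀ K : ℕ, c * K ≤ ((K - jstar K : ℕ) : ℝ))
    (hmajA : ∀ K, ∑ x ∈ X K, q K x ≤ V * r ^ (K - jstar K))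
    (hmajB : ∀ K, ∑ x ∈ X' K, q' K x ≤ V * r ^ (K - jstar K)) :
    ∃ K₀ : ℕ, RelWeightBound l₀ T A B (fun K t => if K₀ ≤ K then Bad K t else ∅)
      (Set.indicator {K | K₀ ≤ K} fun K => V * R * r ^ (K - jstar K)) := by
  have hmA : ∀ K, ∑ x ∈ X K, q K x * R ≤ V * R * r ^ (K - jstar K) := fun K => by
    rw [sum_mul_const_eq, mul_right_comm]
    exact mul_le_mul_of_nonneg_right (hmajA K) hR
  have hmB : ∀ K, ∑ x ∈ X' K, q' K x * R ≤ V * R * r ^ (K - jstar K) := fun K => by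
    rw [sum_mul_const_eq, mul_right_comm]
    exact mul_le_mul_of_nonneg_right (hmajB K) hR
  exact exists_relWeightBound_of_extraction_majorant hA hB hA0 hB0 h0 hr1 (mul_nonneg hV hR) hc hfrac hmA hmB

end End

/-! ## §4 (v1.1, append-only) The converse embedding: a RELATIVE class-level display inhabits P2's term-level
`Regeneration` with the FULL SUM as both envelopes — so the count road of record is reusable verbatim after the re-cut -/

section ToRegeneration

variable {ι γ : Type*} [DecidableEq γ] {l₀ : ℝ} {π : ℕ → ι → γ} {T : ℕ → Finset ι} {A : ℕ → ℝ → ι → ℝ}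
  {Bad' : ℕ → ℝ → Finset γ} {F : ℕ → γ → ℝ} {K₀ : ℕ}

/-- THE CANONICAL DEAD-PAST FACTOR of a term under a relative class display with quotient `F`: its share
`A ∕ (F(class) · Σ_T A)` of the class bound (and `0` where that bound vanishes). [folklore] -/
noncomputable def relDead (π : ℕ → ι → γ) (T : ℕ → Finset ι) (A : ℕ → ℝ → ι → ℝ) (F : ℕ → γ → ℝ) (K : ℕ) (t : ℝ) (τ : ι) : ℝ :=
  if 0 < F K (π K τ) * ∑ σ ∈ T K, A K t σ then A K t τ / (F K (π K τ) * ∑ σ ∈ T K, A K t σ) else 0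

omit [DecidableEq γ] in
/-- the canonical dead-past factor is non-negative for non-negative weights [folklore] -/
theorem relDead_nonneg {K : ℕ} {t : ℝ} {τ : ι} (hA : 0 ≤ A K t τ) : 0 ≤ relDead π T A F K t τ := by
  unfold relDead
  split_ifs with h
  · exact div_nonneg hA h.le
  · exact le_rfl

/-- **A RELATIVE CLASS-LEVEL DISPLAY INHABITS `Regeneration` WITH THE FULL SUM AS BOTH ENVELOPES** (`nlow = nup = Σ_T A`,
`C = 1`, resummation factors `≡ 1`, dead-past factor `relDead`).  Input: the bad classes are live classes of terms, the
weights are non-negative on `T K`, the quotients are non-negative, and THE display `classWeight c ≤ F K c · Σ_{T K} A` on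
the bad classes from `K₀` on.  Consequence: every consumer of P2's `Regeneration` (the count road
`HistoryAssemblyTreesLE.hybridNE7_of_treeBinders_canonLE` → … → `T4LiveGasToTerms`) runs VERBATIM on the re-cut display,
with the envelope constant `1` in place of `constOf … Nup` — no sup-dressing, no (2.50) floor, no curly envelope. [folklore] -/
theorem regeneration_of_relativeClasses
    (bad_subset : ∀ K t, |t| ≤ l₀ → K₀ ≤ K → Bad' K t ⊆ T4LiveClassFibration.classIndex π T K)
    (hA : ∀ K t, |t| ≤ l₀ → K₀ ≤ K → ∀ τ ∈ T K, 0 ≤ A K t τ)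
    (hF : ∀ K t, |t| ≤ l₀ → K₀ ≤ K → ∀ c ∈ Bad' K t, 0 ≤ F K c)
    (fibRel : ∀ K t, |t| ≤ l₀ → K₀ ≤ K → ∀ c ∈ Bad' K t,
      T4LiveClassFibration.classWeight π T A K t c ≤ F K c * ∑ σ ∈ T K, A K t σ) :
    T4LiveClassFibration.Regeneration l₀ π T A Bad' (relDead π T A F) F (fun _ _ => 1)
      (fun K t => ∑ σ ∈ T K, A K t σ) (fun K t => ∑ σ ∈ T K, A K t σ) 1 K₀ where
  bad_subset := bad_subset
  low _ _ _ _ := le_rfl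
  up K t ht hK c hc τ hτ := by
    obtain ⟨hτT, hπ⟩ := T4LiveClassFibration.mem_fibre.1 hτ
    unfold relDead
    rw [hπ]
    split_ifs with h
    · rw [mul_assoc, div_mul_cancel₀ _ h.ne']
    · -- the class bound vanishes: every weight of the fibre is `0`
      have hcw : A K t τ ≤ T4LiveClassFibration.classWeight π T A K t c :=
        Finset.single_le_sum (fun σ hσ => hA K t ht hK σ (T4LiveClassFibration.fibre_subset K c hσ)) hτ
      have h0 : F K c * ∑ σ ∈ T K, A K t σ ≤ 0 := not_lt.mp h
      have : A K t τ ≤ 0 := hcw.trans ((fibRel K t ht hK c hc).trans h0)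
      have : A K t τ = 0 := le_antisymm this (hA K t ht hK τ hτT)
      rw [this, zero_mul, zero_mul]
  dead_nonneg K t ht hK c hc τ hτ :=
    relDead_nonneg (hA K t ht hK τ (T4LiveClassFibration.fibre_subset K c hτ))
  resum K t ht hK c hc := by
    by_cases h : 0 < F K c * ∑ σ ∈ T K, A K t σ
    · have hrw : ∀ τ ∈ T4LiveClassFibration.fibre π T K c,
          relDead π T A F K t τ = A K t τ / (F K c * ∑ σ ∈ T K, A K t σ) := by
        intro τ hτ
        obtain ⟨-, hπ⟩ := T4LiveClassFibration.mem_fibre.1 hτ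
        unfold relDead
        rw [hπ, if_pos h]
      rw [Finset.sum_congr rfl hrw, ← Finset.sum_div]
      exact div_le_one_of_le₀ (fibRel K t ht hK c hc) h.le
    · have hrw : ∀ τ ∈ T4LiveClassFibration.fibre π T K c, relDead π T A F K t τ = 0 := by
        intro τ hτ
        obtain ⟨-, hπ⟩ := T4LiveClassFibration.mem_fibre.1 hτ
        unfold relDead
        rw [hπ, if_neg h]
      rw [Finset.sum_congr rfl hrw, Finset.sum_const_zero]
      exact zero_le_one
  F_nonneg := hF
  nup_nonneg K t ht hK := Finset.sum_nonneg (hA K t ht hK)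
  ratio _ _ _ _ := by rw [one_mul]

/-- **… and from `ExtractionLaws` read at the class level** (pinned classes `X K`, sub-classes the fibres): the display
`extract` on `X K` IS `fibRel` with `F := q`, so `Regeneration` is inhabited with bad classes `X K` (source-free).
[folklore] -/
theorem regeneration_of_extractionLaws {X : ℕ → Finset γ} {q : ℕ → γ → ℝ} {Bad : ℕ → ℝ → Finset ι}
    (h : ExtractionLaws l₀ T A Bad X (fun K c => T4LiveClassFibration.fibre π T K c) q)
    (hX : ∀ K, K₀ ≤ K → X K ⊆ T4LiveClassFibration.classIndex π T K)
    (hA : ∀ K t, |t| ≤ l₀ → K₀ ≤ K → ∀ τ ∈ T K, 0 ≤ A K t τ) :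
    T4LiveClassFibration.Regeneration l₀ π T A (fun K _ => X K) (relDead π T A q) q (fun _ _ => 1)
      (fun K t => ∑ σ ∈ T K, A K t σ) (fun K t => ∑ σ ∈ T K, A K t σ) 1 K₀ :=
  regeneration_of_relativeClasses (fun K _ _ hK => hX K hK) hA (fun K _ _ _ c hc => h.q_nonneg K c hc)
    (fun K t ht _ c hc => h.extract K t ht c hc)

end ToRegeneration

end Summit.QuantumFields.BalabanUV.T4Continuum.NE7b.PinnedExtraction
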